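import Literature.AlgebraicGeometry.HodgeTheory.HodgeRiemannDegreeOneProofs
import HarnessLib

/-!
# Crux `WeilSixfoldsSqrtMinus7` (stmt-HodgeConjecture-1260), line `hyperbolic-eightfold-descent` — sub-goal HR₁ `stub_hodgeRiemannOne`: Hodge–Riemann in degree one for the hyperplane class, CLOSED

Route `HeckePrymWeil`. The registered named-fact stub HR₁ of the line's skeleton r5
(`Cruxes/WeilSixfoldsSqrtMinus7/Lines/hyperbolic_eightfold_descent.lean`): for `X` smooth projective
of dimension `d ≥ 1`, a projective embedding `e` and a non-zero rational `a ∈ H²(ℙᴺ(ℂ); ℂ)`, there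
is a non-zero top class `ω₀` such that `i · (e^*a)^{d-1} ∪ x ∪ x̄` is a positive real multiple of `ω₀`
for every non-zero `x` of Hodge type `(1,0)` (C. Voisin, *Hodge Theory and Complex Algebraic Geometry
I*, Thm. 6.32 at `k = 1` with §7.1.2 / Thm. 7.10). It was filed as the one input of the line's Weil
signature computation (`stub_weilSignature`) that the tree lacked; within hours the tree acquired
the THEOREM `HodgeTheory.hodgeRiemann_degreeOne_of_isOfHodgeType`
(`Literature/AlgebraicGeometry/HodgeTheory/HodgeRiemannDegreeOneProofs`, dimension spelled `d + 1`,
with `ω₀` moreover rational), of which the stub is the re-indexing `d = d' + 1`. No named fact remains.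
-/

noncomputable section

-- single-problem summit (Problem = Summit): the mandated namespace repeats `HodgeConjecture`.
set_option linter.dupNamespace false

open CategoryTheory
open Literature.AlgebraicGeometry Literature.AlgebraicGeometry.Motives
  Literature.AlgebraicGeometry.HodgeTheory Literature.AlgebraicTopology.SingularHomology
  Literature.Geometry.Kaehler

namespace Summit.HodgeConjecture.HodgeConjecture.Theorems.WeilSixfoldsSqrtMinus7.HyperbolicEightfoldDescent

/-- **Sub-goal HR₁ of line `hyperbolic-eightfold-descent`, closed: Hodge–Riemann in degree one for
the hyperplane class** — for `X` smooth projective of dimension `d ≥ 1`, an embedding `e`, a non-zero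
rational `a ∈ H²(ℙᴺ(ℂ); ℂ)`: a non-zero `ω₀ ∈ H^{2d}(X(ℂ); ℂ)` with `i·(e^*a)^{d-1} ∪ x ∪ x̄ = r·ω₀`,
`r > 0`, for every non-zero `x` of type `(1,0)` (Voisin I Thm. 6.32 at `k = 1`; the tree's
`hodgeRiemann_degreeOne_of_isOfHodgeType` at `d = d' + 1`, forgetting the rationality of `ω₀`).
[cite: VoisinHodgeI2002, §6.3.2 Thm. 6.32, §7.1.2 and Thm. 7.10] -/
theorem stub_hodgeRiemannOne :
    ∀ (d : ℕ) (X : SchemeOver ℂ), IsSmoothProjective d X → 1 ≤ d →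
      ∀ (e : ProjectiveEmbedding X) (a : complexBetti (projectiveSpace e.n ℂ) 2),
        IsRationalClass a → a ≠ 0 →
        ∃ ω₀ : complexBetti X (2 + 2 * (d - 1)), ω₀ ≠ 0 ∧
          ∀ x : complexBetti X 1, IsOfHodgeType d X 1 1 0 x → x ≠ 0 →
            ∃ r : ℝ, 0 < r ∧
              Complex.I • polarizationPairingOne X (complexBetti.map e.ι 2 a) (d - 1) x
                (conjClass (ComplexPoints X) 1 x) = ((r : ℝ) : ℂ) • ω₀ := by
  intro d X hX hd e a ha ha0
  obtain ⟨d', rfl⟩ : ∃ d', d = d' + 1 := ⟨d - 1, by omega⟩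
  obtain ⟨ω₀, -, hω₀, h⟩ := hodgeRiemann_degreeOne_of_isOfHodgeType hX e ha ha0
  exact ⟨ω₀, hω₀, fun x hx hx0 => h x hx hx0⟩

end Summit.HodgeConjecture.HodgeConjecture.Theorems.WeilSixfoldsSqrtMinus7.HyperbolicEightfoldDescent

end
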